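import Summits.QuantumAdvantage.AdviceFreeQNC0.AffBells25FullSupportRigidity
import Summits.QuantumAdvantage.AdviceFreeQNC0.AffBells25Linearisation
import Summits.QuantumAdvantage.AdviceFreeQNC0.AffBells25Euler
import Summits.QuantumAdvantage.AdviceFreeQNC0.AffBells25Covering
import HarnessLib

/-!
# THEOREM B′ (ROUND-24 §2.10): `AffBells25.StrongFullSupportRigidityLin` — the linear rigidity threshold, PROVED

Prover seat qn-prover-3 g14 (ask P-25 of planner qn-p1 g25).  Assembly of the typed chain
`AffBells25RigidityChain.lean` (= Sketch25L, planner qn-p1 g25) proved in `AffBells25Omega.lean` (L1, L2),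
`AffBells25Linearisation.lean` (L3), `AffBells25Euler.lean` (L4, L7), `AffBells25Covering.lean` (L5, L6):

* **`strongFullSupportRigidityLin : AffBells25.StrongFullSupportRigidityLin`** — for `Z ≥ 7` and `2K ≤ Z`, an XOR of
  `K` FULL-SUPPORT `MOD₃` tests `[⟨γ_g, y⟩ = c_g]` that is constant on a parity class of `{0,1}^Z` is BALANCED
  (in every parallel class `{±γ_g}` the three signed-residue counts are pairwise congruent mod 2).
  PROOF (§2.10 (a)–(d)).  If some class `g₀` is unbalanced, its `𝔽₄`-coefficient `A_{γ_{g₀}} ≠ 0`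
  (`coefA_self_ne_zero_of_unbalanced`), while `N = {δ sign : A_δ ≠ 0} ⊆ {±γ_g}` has `#N ≤ 2K ≤ Z`.  By the
  linearisation (L3), `A_δ = β·ω^{⟨δ,1⟩} + ω^{−⟨δ,1⟩}F_S(δ)` with `β = K + b ∈ 𝔽₂`:
  - `β = 0`: `N = supp F_S`, nonempty, closed under complement and with no outside vertex having exactly one
    `N`-neighbour (L7a, from the Euler recurrence L4 and antipodality); the covering lemma (L5) gives `#N ≥ Z + 2`;
  - `β = 1`: `N = {F_S ≠ ω^{2⟨δ,1⟩}}`; by the interior-point lemma (L7b) every point outside `N` — all of them if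
    `Z` is odd, those of the class `P_σ` if `Z` is even — has an `N`-neighbour, so the domination count (L6) gives
    `2^{Z−1} ≤ (Z+1)·#N ≤ (Z+1)Z`, false for `Z ≥ 7` (`quad_lt_two_pow`).
* **`fullSupportRigidityLin K₀ : AffBells24.FullSupportRigidity K₀ (max 7 (2·K₀))`** (planner's proved glue
  `fullSupportRigidity_of_lin`) — the (NP₀)-rung rigidity conjecture `FullSupportRigidity` of Sketch24/ROUND-23 §3.3
  with a LINEAR threshold; together with `AffBells25SymmetricRelations.notFullSupportRigiditySucc`
  (`¬ FullSupportRigidity (Z₀+1) Z₀`, `Z₀ ≥ 3`) the threshold is pinned in `[K₀+1, max 7 (2K₀)]`.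
* **`strongFullSupportRigidity : AffBells25.StrongFullSupportRigidity`** (Theorem B, `4·3^K < Z`) and
  `fullSupportRigidityExp K₀ : FullSupportRigidity K₀ (4·3^K₀+1)` as corollaries (`K = 0` is vacuous; else
  `Z > 12`).  The intermediate typed targets `ClassToCube` / `FullCubeLemma` (P-25a/b) are not needed and not proved.

WHAT THIS IS NOT: instrument for the (NP₀) rung of plan S2 / crux stmt-QuantumAdvantage-22907 (route DWalkThree,
`p = 3` side): an exact structural theorem about short relations among full-support `MOD₃` tests on a parity class;
no strategy bound, no 99 %-regime statement; separation NOT moved.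
-/

namespace Summit.QuantumAdvantage.AdviceFreeQNC0

namespace AffBells25L

open Finset AffBells24 AffBells25 Polynomial

/-! ### Small facts for the assembly -/

/-- The numerical inequality of the `β = 1` branch: `Z(Z+1) < 2^{Z−1}` for `Z ≥ 7`. -/
theorem quad_lt_two_pow {Z : ℕ} (hZ : 7 ≤ Z) : Z * (Z + 1) < 2 ^ (Z - 1) := by
  induction Z, hZ using Nat.le_induction with
  | base => norm_num
  | succ n hn ih =>
    have h2 : 2 ^ (n + 1 - 1) = 2 * 2 ^ (n - 1) := by
      rw [← pow_succ']; congr 1; omega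
    rw [h2]
    nlinarith [ih, hn]

/-- A coefficient `A_δ ≠ 0` needs a row `γ_g ∈ {δ, −δ}`. -/
theorem exists_row_of_coefA_ne_zero {Z K : ℕ} (γ : Fin K → Fin Z → ZMod 3) (c : Fin K → ZMod 3)
    (δ : Fin Z → ZMod 3) (h : coefA γ c δ ≠ 0) : ∃ g, γ g = δ ∨ γ g = -δ := by
  by_contra hne
  push Not at hne
  apply h
  unfold coefA
  rw [filter_false_of_mem fun g _ => (hne g).1, filter_false_of_mem fun g _ => (hne g).2, sum_empty, sum_empty,
    add_zero]

/-- The Boolean point of a sign vector: `signOf (e ↦ [δ_e = 2]) = δ` for `δ ∈ {1,2}^Z`. -/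
theorem signOf_decide {Z : ℕ} (δ : Fin Z → ZMod 3) (hδ : IsSign δ) :
    signOf (fun e => decide (δ e = 2)) = δ := by
  funext e
  show (if decide (δ e = 2) = true then (2 : ZMod 3) else 1) = δ e
  have h3 : ∀ a : ZMod 3, a ≠ 0 → a = 1 ∨ a = 2 := by decide
  rcases h3 (δ e) (hδ e) with h | h <;> rw [h] <;> decide

/-- `signOf` is injective: `(e ↦ [signOf y e = 2]) = y`. -/
theorem decide_signOf {Z : ℕ} (y : Fin Z → Bool) : (fun e => decide (signOf y e = 2)) = y := by
  funext e
  show decide ((if y e = true then (2 : ZMod 3) else 1) = 2) = y e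
  cases y e <;> decide

/-- **The count `#N ≤ 2K`**: the Boolean points `y` with `A_{signOf y} ≠ 0` are among the `≤ 2K` points `±γ_g`. -/
theorem card_filter_coefA_ne_zero_le {Z K : ℕ} (γ : Fin K → Fin Z → ZMod 3) (c : Fin K → ZMod 3) :
    ((univ : Finset (Fin Z → Bool)).filter fun y => coefA γ c (signOf y) ≠ 0).card ≤ 2 * K := by
  classical
  have hsub : ((univ : Finset (Fin Z → Bool)).filter fun y => coefA γ c (signOf y) ≠ 0) ⊆
      (univ.image fun g => fun e => decide (γ g e = 2)) ∪ univ.image fun g => fun e => decide ((-γ g) e = 2) := by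
    intro y hy
    rw [mem_filter] at hy
    obtain ⟨g, hg | hg⟩ := exists_row_of_coefA_ne_zero γ c (signOf y) hy.2
    · exact mem_union_left _ (mem_image.2 ⟨g, mem_univ _, by rw [hg, decide_signOf]⟩)
    · refine mem_union_right _ (mem_image.2 ⟨g, mem_univ _, ?_⟩)
      rw [hg, neg_neg, decide_signOf]
  calc ((univ : Finset (Fin Z → Bool)).filter fun y => coefA γ c (signOf y) ≠ 0).card
      ≤ ((univ.image fun g => fun e => decide (γ g e = 2)) ∪
          univ.image fun g => fun e => decide ((-γ g) e = 2)).card := card_le_card hsub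
    _ ≤ (univ.image fun g => fun e => decide (γ g e = 2)).card +
          (univ.image fun g => fun e => decide ((-γ g) e = 2)).card := card_union_le _ _
    _ ≤ K + K := Nat.add_le_add (card_image_le.trans (by rw [card_univ, Fintype.card_fin]))
          (card_image_le.trans (by rw [card_univ, Fintype.card_fin]))
    _ = 2 * K := by ring

/-- `β ∈ 𝔽₂`: the scalar `K + b` of the linearisation is `0` or `1` in `R`. -/
theorem beta_cases (K : ℕ) (b : Bool) :
    ((K : R) + (if b then 1 else 0)) = 0 ∨ ((K : R) + (if b then 1 else 0)) = 1 := by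
  rw [natCast_eq_bit K]
  cases decide (K % 2 = 1) <;> cases b <;> simp [F4.add_self]

/-- `β = 1`: `A_δ = ω^{⟨δ,1⟩} + ω^{−⟨δ,1⟩}F(δ)` vanishes iff `F(δ) = ω^{2⟨δ,1⟩}`. -/
theorem piOne_add_eq_zero_iff {Z : ℕ} (δ : Fin Z → ZMod 3) (F : R) :
    piOne δ + ωpow (-(∑ e, δ e)) * F = 0 ↔ F = ωpow (2 * ∑ e, δ e) := by
  unfold piOne
  constructor
  · intro h
    have h1 := eq_add_of_add_eq h
    rw [add_zero] at h1
    have h2 := congrArg (fun x => ωpow (∑ e, δ e) * x) h1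
    simp only [← mul_assoc, ωpow_mul_neg, one_mul] at h2
    rw [h2, two_mul, ωpow_add]
  · intro h
    rw [h, two_mul, ωpow_add, ← mul_assoc, ωpow_neg_mul, one_mul, F4.add_self]

/-! ### The theorem -/

/-- **THEOREM B′** (planner qn-p1 g25, ROUND-24 §2.10): for `Z ≥ 7` and `2K ≤ Z`, an XOR of `K` full-support tests
that is constant on a parity class is balanced. -/
theorem strongFullSupportRigidityLin : StrongFullSupportRigidityLin := by
  classical
  intro Z K σ γ c hfull hZ7 h2K hconst
  -- the constant value `b` on the class
  obtain ⟨b, hb⟩ : ∃ b : Bool, ∀ y ∈ parityClass Z σ, xorTests γ c y = b := by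
    by_cases hne : (parityClass Z σ).Nonempty
    · obtain ⟨y₀, hy₀⟩ := hne
      exact ⟨xorTests γ c y₀, fun y hy => hconst y hy y₀ hy₀⟩
    · exact ⟨false, fun y hy => absurd ⟨y, hy⟩ hne⟩
  by_contra hbal
  unfold AffBells25.Balanced at hbal
  push Not at hbal
  obtain ⟨g₀, r, s, hrs⟩ := hbal
  have hZpos : 0 < Z := by omega
  have hA0 : coefA γ c (γ g₀) ≠ 0 := coefA_self_ne_zero_of_unbalanced γ c g₀ (self_ne_neg γ hfull hZpos g₀) hrs
  -- the exceptional set and the linearisation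
  set S := excS γ c σ b with hSdef
  have hS : S ⊆ parityClass Z (σ + 1) := by rw [hSdef]; unfold excS; exact filter_subset _ _
  have hlin := linearisation Z K σ γ c b hfull hb
  -- the non-vanishing set `N` and its size
  set N := (univ : Finset (Fin Z → Bool)).filter fun y => coefA γ c (signOf y) ≠ 0 with hNdef
  have hNcard : N.card ≤ 2 * K := card_filter_coefA_ne_zero_le γ c
  have hy₀N : (fun e => decide (γ g₀ e = 2)) ∈ N := by
    rw [hNdef, mem_filter, signOf_decide (γ g₀) (hfull g₀)]
    exact ⟨mem_univ _, hA0⟩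
  have hquad := quad_lt_two_pow hZ7
  rcases beta_cases K b with hβ | hβ
  · -- β = 0 : N = supp F_S, covering lemma
    have hNeq : N = suppF S := by
      ext y
      rw [hNdef, mem_filter, mem_suppF_iff, hlin (signOf y) (isSign_signOf y), hβ, zero_mul, zero_add]
      simp only [mem_univ, true_and]
      constructor
      · intro h hF; rw [hF, mul_zero] at h; exact h rfl
      · intro h hA; exact h (eq_zero_of_ωpow_mul_eq_zero hA)
    obtain ⟨hcl, hno⟩ := supportFacts Z (σ + 1) S hS
    have hcov := coveringLemma Z (suppF S) (by omega) ⟨_, hNeq ▸ hy₀N⟩ hcl hno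
    rw [← hNeq] at hcov
    omega
  · -- β = 1 : N = {F_S ≠ Π̄}, interior points + domination
    have hNeq : N = suppF1 S := by
      ext y
      rw [hNdef, mem_filter, mem_suppF1_iff, hlin (signOf y) (isSign_signOf y), hβ, one_mul, not_iff_not.symm]
      simp only [mem_univ, true_and, not_not]
      exact piOne_add_eq_zero_iff (signOf y) (FS S (signOf y))
    have hint := interiorPointLemma Z (σ + 1) S hS
    rcases Nat.even_or_odd Z with hev | hodd
    · -- Z even: dominate the class P_σ
      have hdom : ∀ w ∈ parityClass Z σ, w ∉ suppF1 S → ∃ e, nbr e w ∈ suppF1 S := by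
        intro w hw hwU
        by_contra hno
        push Not at hno
        have h := (hint w hwU hno).2
        unfold parityClass at hw
        rw [mem_filter] at hw
        have hsum := card_true_add_card_false w
        rcases hev with ⟨m, hm⟩
        omega
      have hD := dominationCount Z (suppF1 S) (parityClass Z σ) hdom
      rw [card_parityClass (by omega), ← hNeq] at hD
      have : 2 ^ (Z - 1) ≤ (Z + 1) * Z :=
        hD.trans (Nat.mul_le_mul_left _ (hNcard.trans h2K))
      rw [mul_comm] at this
      omega
    · -- Z odd: dominate the whole cube
      have hdom : ∀ w ∈ (univ : Finset (Fin Z → Bool)), w ∉ suppF1 S → ∃ e, nbr e w ∈ suppF1 S := by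
        intro w _ hwU
        by_contra hno
        push Not at hno
        have h := (hint w hwU hno).1
        rcases hodd with ⟨m, hm⟩
        omega
      have hD := dominationCount Z (suppF1 S) univ hdom
      rw [card_univ, Fintype.card_fun, Fintype.card_bool, Fintype.card_fin, ← hNeq] at hD
      have h1 : 2 ^ Z ≤ (Z + 1) * Z := hD.trans (Nat.mul_le_mul_left _ (hNcard.trans h2K))
      have h2 : 2 ^ (Z - 1) ≤ 2 ^ Z := Nat.pow_le_pow_right (by norm_num) (by omega)
      rw [mul_comm] at h1
      omega

/-- **COROLLARY (linear threshold for the (NP₀) rigidity conjecture)**: `FullSupportRigidity K₀ (max 7 (2·K₀))` for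
every `K₀` — via the planner's proved glue `fullSupportRigidity_of_lin`. -/
theorem fullSupportRigidityLin (K₀ : ℕ) : FullSupportRigidity K₀ (max 7 (2 * K₀)) :=
  fullSupportRigidity_of_lin strongFullSupportRigidityLin K₀

/-- **THEOREM B** (ROUND-24 §2.4, the exponential-threshold form) as a corollary of B′: for `4·3^K < Z`, an XOR of
`K` full-support tests constant on a parity class is balanced (`K = 0`: no class to check; `K ≥ 1`: `Z ≥ 13`). -/
theorem strongFullSupportRigidity : StrongFullSupportRigidity := by
  intro Z K σ γ c hfull hZ hconst
  rcases Nat.eq_zero_or_pos K with hK | hK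
  · subst hK
    intro g₀
    exact Fin.elim0 g₀
  · have h3 : K < 3 ^ K := Nat.lt_pow_self (by norm_num)
    have h3' : 3 ≤ 3 ^ K := Nat.le_self_pow (by omega) 3
    exact strongFullSupportRigidityLin Z K σ γ c hfull (by omega) (by omega) hconst

/-- `FullSupportRigidity K₀ (4·3^K₀ + 1)` (the planner's glue `fullSupportRigidity_of_strong`). -/
theorem fullSupportRigidityExp (K₀ : ℕ) : FullSupportRigidity K₀ (4 * 3 ^ K₀ + 1) :=
  fullSupportRigidity_of_strong strongFullSupportRigidity K₀

end AffBells25L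

end Summit.QuantumAdvantage.AdviceFreeQNC0
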